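import Summits.ResolutionOfSingularities.ResolutionOfSingularities.Theorems.RadicialJungCleanModelsCleanPermissibleDerivationObstruction
import Mathlib.RingTheory.Ideal.KrullsHeightTheorem
import HarnessLib

/-!
# Route `RadicialJung`, crux `CleanModels` (stmt-ResolutionOfSingularities-15917), line `Sketch` rev 35, stub 6 `stub_cleanProp44` (X44c):
# THE SECOND-ORDER CRITERION FOR CURVE CENTRES (def-free kernel tool)

Seat `leafhand-res-radicialjung-1` g0 (land-only hand).  Packages the argument of
`RadicialJungCleanModelsCleanPermissibleBlowupWitness.lean` (`not_cleanPermissibleAt_strictTransform_blowupWitness`) as a reusable criterion,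
complementing the first-order `not_cleanPermissibleAt_of_derivations` of `RadicialJungCleanModelsCleanPermissibleDerivationObstruction.lean`:

* `not_cleanPermissibleAt_of_derivations₂` — let `R` be local with `dim R = N` and `p`-perfect residue field, `f : R → F` injective into a field
  of characteristic `p`, and `I` a centre ideal of height `≥ N - 1` (a CURVE centre; e.g. `I` generated by `N - 1` members of a regular system of
  parameters, `IsRsopPart.natCast_le_height_span_range`).  Suppose (1) every minimal generator `x ∈ I ∖ 𝔪²` fails the FIRST-order test for some
  derivation `d` of `R` extending along `f` to a derivation of `F` killing `G` (`x ∤ d x`), and (2) every transversal parameter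
  `x ∈ 𝔪 ∖ (I + 𝔪²)` fails the SECOND-order test for some such `d` VANISHING AT THE POINT (`d (R) ⊆ 𝔪` and `d x ∉ x · 𝔪`).  Then the line of `G`
  is NOT clean-permissible at `R` for `I`.  (By (1) all exponents on the `I`-block are divisible by `p`; Krull's height theorem and the dimension
  count leave exactly ONE transversal member `w`, carrying an exponent prime to `p`; the logarithmic derivative
  `IsRsopPart.sum_logDerivative_mem_maximalIdeal` then puts `d w` in `w 𝔪`, against (2).)

* (appended) `cleanPermissibleAt_of_rep_transversal` — a representative which is a parameter transversal to the curve makes it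
  clean-permissible (why the lead's witness is bad at ONE point only).
* (appended) `cleanPermissibleAt_of_monomial_vec3` — the positive counterpart: an adapted monomial representative with some exponent prime to
  `p` makes every curve centre cut out by two of the three parameters clean-permissible.

Typical use: exceptional coordinates `z` pass the first-order test for every derivation tangent to the exceptional divisor (`z ∣ d z`), but a
tangent derivation `δ` with `δ z = -z` fails the second-order one.  Honest framing: OURS, elementary; a TOOL.  Nothing here proves X44c, any case of
`CleanModels`, or resolution of singularities in characteristic `p`.
Setting only: [cite: Piltant2013, §2 Axiom 4] [cite: Matsumura1987, Thm. 13.5 (Krull), Thm. 14.2].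
-/

noncomputable section

set_option linter.dupNamespace false -- mandated namespace of this single-conjunct summit

open IsLocalRing
open Literature.AlgebraicGeometry.Resolution

namespace Summit.ResolutionOfSingularities.ResolutionOfSingularities.Theorems.RadicialJung.CleanModels

universe u

/-- The number of members of an adapted system generating `I` is at least the height of `I` (Krull's height theorem). [cite: Matsumura1987, Thm. 13.5] -/
theorem height_le_of_span_range_eq {R : Type u} [CommRing R] [IsNoetherianRing R] {n : ℕ} (c : Fin n → R) {I : Ideal R}
    (hcI : Ideal.span (Set.range c) = I) (hI : I ≠ ⊤) : I.height ≤ n := by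
  classical
  have h1 : I.height ≤ I.spanFinrank := Ideal.height_le_spanFinrank I hI
  have h2 : I.spanFinrank ≤ n := by
    rw [← hcI]
    refine (Submodule.spanFinrank_span_le_ncard_of_finite (Set.finite_range c)).trans ?_
    have hr : Set.range c = ↑(Finset.univ.image c) := by ext a; simp
    rw [hr, Set.ncard_coe_finset]
    exact (Finset.card_image_le).trans (by simp)
  exact h1.trans (by exact_mod_cast h2)

/-- **The second-order criterion for curve centres.**  `R` local of dimension `N` with `p`-perfect residue field, `f : R → F` injective into a
field of characteristic `p`, `I` of height `≥ N - 1`.  If every minimal generator of `I` fails the first-order test (`x ∤ d x`) and every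
transversal parameter fails the second-order test (`d (R) ⊆ 𝔪`, `d x ∉ x 𝔪`) — each for some derivation of `R` extending along `f` to a
derivation of `F` killing `G` —, then the line of `G` is not clean-permissible at `R` for `I`.
[cite: Piltant2013, §2 Axiom 4] [cite: Matsumura1987, Thm. 13.5, Thm. 14.2] -/
theorem not_cleanPermissibleAt_of_derivations₂ {R : Type u} {F : Type u} [CommRing R] [IsLocalRing R] [Field F] {p : ℕ}
    [Fact p.Prime] [CharP F p] {f : R →+* F} (hf : Function.Injective f) {G : F} {I : Ideal R}
    (hperf : ∀ u : R, ∃ c : R, u - c ^ p ∈ maximalIdeal R) {N : ℕ} (hdim : ringKrullDim R = N)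
    (hht : ((N - 1 : ℕ) : ℕ∞) ≤ I.height)
    (hgen : ∀ x ∈ I, x ∉ maximalIdeal R ^ 2 →
      ∃ (D : Derivation ℤ F F) (d : Derivation ℤ R R), (∀ r, D (f r) = f (d r)) ∧ D G = 0 ∧ ¬ x ∣ d x)
    (htrans : ∀ x ∈ maximalIdeal R, x ∉ I ⊔ maximalIdeal R ^ 2 →
      ∃ (D : Derivation ℤ F F) (d : Derivation ℤ R R), (∀ r, D (f r) = f (d r)) ∧ D G = 0 ∧
        (∀ r : R, d r ∈ maximalIdeal R) ∧ ∀ r ∈ maximalIdeal R, d x ≠ x * r) :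
    ¬ CleanPermissibleAt p f G I := by
  classical
  haveI : CharP R p := f.charP hf p
  intro hcp
  obtain ⟨n, l, c, w, a, b, u, hz, hcI, hu, hex, hkill⟩ := hcp.exists_adapted_apply_eq_zero hf hperf
  haveI := hz.isRegularLocalRing
  -- first order: every `c k` has exponent divisible by `p`
  have ha : ∀ k, p ∣ a k := by
    intro k
    by_contra hk
    have hck : c k ∈ I := hcI ▸ Ideal.subset_span ⟨k, rfl⟩
    have hck2 : c k ∉ maximalIdeal R ^ 2 := by
      have h2 := hz.not_mem_sq (Fin.castAdd l k); rwa [Fin.append_left] at h2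
    obtain ⟨D, d, hcomp, hDG, hnd⟩ := hgen (c k) hck hck2
    apply hnd
    have h1 := hz.dvd_derivation_apply_of_apply_eq_zero p d hu (Fin.append a b) (hkill D d hcomp hDG) (i := Fin.castAdd l k)
      (by rwa [Fin.append_left])
    rwa [Fin.append_left] at h1
  -- so some `w m` carries an exponent prime to `p`
  obtain ⟨m, hm⟩ : ∃ m, ¬ p ∣ b m := by
    rcases hex with ⟨k, hk⟩ | hmex
    · exact absurd (ha k) hk
    · exact hmex
  -- dimension count: `n + l ≤ N`, `N - 1 ≤ height I ≤ n`, `1 ≤ l` ⟹ `l = 1`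
  have hnl : n + l ≤ N := by
    obtain ⟨-, e, -, hd, -⟩ := hz
    rw [hdim] at hd
    have h3 : ((n + l + e : ℕ) : WithBot ℕ∞) = (N : ℕ) := by rw [← hd]
    have h3' : n + l + e = N := by exact_mod_cast h3
    omega
  have hItop : I ≠ ⊤ := by
    intro hI
    rcases Nat.eq_zero_or_pos n with hn | hn
    · subst hn
      have h0 : Set.range c = ∅ := Set.range_eq_empty _
      rw [h0, Ideal.span_empty] at hcI
      exact (hI ▸ hcI ▸ bot_ne_top (α := Ideal R)) rfl
    · have hle : I ≤ maximalIdeal R := by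
        rw [← hcI, Ideal.span_le]
        rintro _ ⟨k, rfl⟩
        have h2 := hz.mem_maximalIdeal (Fin.castAdd l k); rwa [Fin.append_left] at h2
      exact (maximalIdeal.isMaximal R).ne_top (top_le_iff.mp (hI ▸ hle))
  have hn : N - 1 ≤ n := by
    have h1 : I.height ≤ n := height_le_of_span_range_eq c hcI hItop
    exact_mod_cast hht.trans h1
  have hl1 : 1 ≤ l := by
    rcases Nat.eq_zero_or_pos l with hl | hl
    · subst hl; exact absurd m.2 (by simp)
    · exact hl
  have hl : l = 1 := by omega
  subst hl
  have hm0 : m = 0 := Subsingleton.elim m 0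
  subst hm0
  -- second order at the transversal member `w 0`
  have hw0m : w 0 ∈ maximalIdeal R := by
    have h1 := hz.mem_maximalIdeal (Fin.natAdd n 0); rwa [Fin.append_right] at h1
  have hw02 : w 0 ∉ I ⊔ maximalIdeal R ^ 2 := by
    rw [← hcI]; exact append_right_not_mem_span_sup_sq hz 0
  obtain ⟨D, d, hcomp, hDG, hdm, hnd⟩ := htrans (w 0) hw0m hw02
  obtain ⟨r, hr, hsum⟩ := hz.sum_logDerivative_mem_maximalIdeal p d hdm hu (Fin.append a b) (hkill D d hcomp hDG)
  have hsum' : ((b 0 : ℕ) : R) * r (Fin.natAdd n 0) ∈ maximalIdeal R := by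
    rw [Fin.sum_univ_add] at hsum
    simp only [Fin.append_left, Fin.append_right, Fin.sum_univ_one] at hsum
    have hc0 : ∑ k : Fin n, ((a k : ℕ) : R) * r (Fin.castAdd 1 k) = 0 :=
      Finset.sum_eq_zero fun k _ => by rw [(CharP.cast_eq_zero_iff R p _).mpr (ha k), zero_mul]
    rwa [hc0, zero_add] at hsum
  have hb : IsUnit (((b 0 : ℕ) : R)) := isUnit_natCast_of_not_dvd p hm
  have hrm : r (Fin.natAdd n 0) ∈ maximalIdeal R := (Ideal.unit_mul_mem_iff_mem _ hb).mp hsum'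
  have hdw : d (w 0) = w 0 * r (Fin.natAdd n 0) := by
    have h1 := hr (Fin.natAdd n 0) (by rwa [Fin.append_right]); rwa [Fin.append_right] at h1
  exact hnd _ hrm hdw

/-! ## The positive counterpart: adapted monomials (appended, same seat) -/

/-- **Adapted monomials are clean-permissible (curve centres in dimension `3`).**  `R` regular local of dimension `3` with regular system of
parameters `(z₀, z₁, z₂)`; if a non-trivial representative `Σ c_j^p G^j` of the line of `G` equals `f (u · z₀^{e₀} z₁^{e₁} z₂^{e₂})` with `u` a unit
and SOME exponent prime to `p`, then the line is clean-permissible at `R` for the curve centre `I = (z₀, z₁)` (adapted system `(z₀, z₁; z₂)`).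
Typical uses: the axis `V(z, x)` for `G = x y`; after a point blow-up at a single-factor clean point (`h = u t'^a w^b` with `w` exceptional), the
line `L_h = V(w, t')`, every line `V(w, ℓ)` of the exceptional plane transversal to `L_h` (`(w, ℓ, t')` a regular system), and — off `L_h`, where
`t'` is a unit — every line of the exceptional plane whatsoever. [cite: Piltant2013, §2 Axiom 4] -/
theorem cleanPermissibleAt_of_monomial_vec3 {R : Type u} {F : Type u} [CommRing R] [IsLocalRing R] [Field F] {p : ℕ} [Fact p.Prime]
    (f : R →+* F) (hR : IsRegularLocalRing R) (hdim : ringKrullDim R = 3) {z₀ z₁ z₂ : R}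
    (h : Ideal.span ({z₀, z₁, z₂} : Set R) = maximalIdeal R) {G : F} (cc : Fin p → F) (hcc : ∃ j : Fin p, (j : ℕ) ≠ 0 ∧ cc j ≠ 0)
    {u : R} (hu : IsUnit u) (e₀ e₁ e₂ : ℕ) (hex : ¬ p ∣ e₀ ∨ ¬ p ∣ e₁ ∨ ¬ p ∣ e₂)
    (hrep : (∑ j : Fin p, cc j ^ p * G ^ (j : ℕ)) = f (u * z₀ ^ e₀ * z₁ ^ e₁ * z₂ ^ e₂)) :
    CleanPermissibleAt p f G (Ideal.span ({z₀, z₁} : Set R)) := by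
  classical
  refine ⟨hR, 2, 1, ![z₀, z₁], ![z₂], ?_, by rw [hdim]; norm_cast, ?_, cc, hcc, Or.inl ⟨![e₀, e₁], ![e₂], u, hu, ?_, ?_⟩⟩
  · have happ : Fin.append ![z₀, z₁] ![z₂] = ![z₀, z₁, z₂] := by
      ext i; fin_cases i <;> rfl
    have hr : Set.range ![z₀, z₁, z₂] = {z₀, z₁, z₂} := by
      ext a
      simp only [Set.mem_range, Set.mem_insert_iff, Set.mem_singleton_iff]
      constructor
      · rintro ⟨i, rfl⟩
        fin_cases i <;> simp
      · rintro (rfl | rfl | rfl)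
        exacts [⟨0, rfl⟩, ⟨1, rfl⟩, ⟨2, rfl⟩]
    rw [happ, hr, h]
  · congr 1
    ext a
    simp only [Set.mem_range, Set.mem_insert_iff, Set.mem_singleton_iff]
    constructor
    · rintro ⟨i, rfl⟩
      fin_cases i <;> simp
    · rintro (rfl | rfl)
      exacts [⟨0, rfl⟩, ⟨1, rfl⟩]
  · rcases hex with h0 | h1 | h2
    · exact Or.inl ⟨0, by simpa using h0⟩
    · exact Or.inl ⟨1, by simpa using h1⟩
    · exact Or.inr ⟨0, by simpa using h2⟩
  · rw [hrep]
    simp [Fin.prod_univ_two, mul_assoc]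

/-- **A transversal representative makes the curve clean-permissible.**  `R` regular local of dimension `3` with regular system of parameters
`(c₁, c₂, t)`, `I = (c₁, c₂)`; if some non-trivial representative `Σ c_j^p G^j` of the line equals `f r` with `r ∈ 𝔪 ∖ (I + 𝔪²)` (a parameter
TRANSVERSAL to the curve), then the line is clean-permissible at `R` for `I`: `(c₁, c₂; r)` is itself an adapted regular system and `r = r¹`.
(This is why the lead's witness `V(t₂, t₁ - t₃²)` is clean-permissible at its closed points `q ≠ 0` over an algebraically closed field:
`t₁ - β^p ≡ 2 a (t₃ - a)` there.) [cite: Piltant2013, §2 Axiom 4] [cite: Matsumura1987, Thm. 14.2] -/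
theorem cleanPermissibleAt_of_rep_transversal {R : Type u} {F : Type u} [CommRing R] [IsLocalRing R] [Field F] {p : ℕ} [Fact p.Prime]
    (f : R →+* F) (hR : IsRegularLocalRing R) (hdim : ringKrullDim R = 3) {c₁ c₂ t : R}
    (h : Ideal.span ({c₁, c₂, t} : Set R) = maximalIdeal R) {G : F} (cc : Fin p → F) (hcc : ∃ j : Fin p, (j : ℕ) ≠ 0 ∧ cc j ≠ 0)
    {r : R} (hrep : (∑ j : Fin p, cc j ^ p * G ^ (j : ℕ)) = f r) (hrm : r ∈ maximalIdeal R)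
    (hrI : r ∉ Ideal.span ({c₁, c₂} : Set R) ⊔ maximalIdeal R ^ 2) :
    CleanPermissibleAt p f G (Ideal.span ({c₁, c₂} : Set R)) := by
  have hc₁m : c₁ ∈ maximalIdeal R := h ▸ Ideal.subset_span (by simp)
  have hc₂m : c₂ ∈ maximalIdeal R := h ▸ Ideal.subset_span (by simp)
  have htm : t ∈ maximalIdeal R := h ▸ Ideal.subset_span (by simp)
  -- `r = A c₁ + B c₂ + Γ t` with `Γ` a unit
  have hr3 : r ∈ Ideal.span ({c₁, c₂, t} : Set R) := h ▸ hrm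
  rw [Ideal.mem_span_insert] at hr3
  obtain ⟨A, y, hy, hrA⟩ := hr3
  obtain ⟨B, Γ, rfl⟩ := Ideal.mem_span_pair.mp hy
  have hΓ : IsUnit Γ := by
    by_contra hΓ
    have hΓm : Γ ∈ maximalIdeal R := (IsLocalRing.mem_maximalIdeal Γ).mpr hΓ
    apply hrI
    rw [hrA]
    refine Ideal.add_mem _ (Ideal.mem_sup_left (Ideal.mul_mem_left _ _ (Ideal.subset_span (by simp))))
      (Ideal.add_mem _ (Ideal.mem_sup_left (Ideal.mul_mem_left _ _ (Ideal.subset_span (by simp)))) (Ideal.mem_sup_right ?_))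
    rw [pow_two]
    exact Ideal.mul_mem_mul hΓm htm
  -- hence `(c₁, c₂, r)` generates `𝔪`
  have hspan : Ideal.span ({c₁, c₂, r} : Set R) = maximalIdeal R := by
    apply le_antisymm
    · rw [Ideal.span_le, Set.insert_subset_iff, Set.insert_subset_iff, Set.singleton_subset_iff]
      exact ⟨hc₁m, hc₂m, hrm⟩
    · rw [← h, Ideal.span_le, Set.insert_subset_iff, Set.insert_subset_iff, Set.singleton_subset_iff]
      refine ⟨Ideal.subset_span (by simp), Ideal.subset_span (by simp), ?_⟩
      obtain ⟨v, hv⟩ := hΓ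
      have ht : t = ↑v⁻¹ * (r - A * c₁ - B * c₂) := by
        rw [hrA, ← hv]
        have h1 : A * c₁ + (B * c₂ + (v : R) * t) - A * c₁ - B * c₂ = (v : R) * t := by ring
        rw [h1, ← mul_assoc, Units.inv_mul, one_mul]
      rw [SetLike.mem_coe, ht]
      exact Ideal.mul_mem_left _ _ (Ideal.sub_mem _ (Ideal.sub_mem _ (Ideal.subset_span (by simp))
        (Ideal.mul_mem_left _ _ (Ideal.subset_span (by simp)))) (Ideal.mul_mem_left _ _ (Ideal.subset_span (by simp))))
  exact cleanPermissibleAt_of_monomial_vec3 f hR hdim hspan cc hcc isUnit_one 0 0 1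
    (Or.inr (Or.inr (by simpa using (Fact.out : p.Prime).one_lt.ne'))) (by rw [hrep]; simp)

end Summit.ResolutionOfSingularities.ResolutionOfSingularities.Theorems.RadicialJung.CleanModels

end
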